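import Summits.BirchSwinnertonDyer.Rank1Residual.GaloisImage.InflationRestrictionSakamotoH3
import Summits.BirchSwinnertonDyer.Rank1Residual.GaloisImage.SmallImageInertiaOrder
import HarnessLib

/-!
# Sakamoto's (H.3) at LEVEL ONE from `p ∤ #ρ̄_{E,p}(Γ_ℚ)` — every small-image row, EVERY prime `p`
# — O8-TAME part 12b (cell `b2b-bsdres`, lane CLASS-CLOSURE, seat cc-typer-1 = typer of record
# N11 / O8, GEN 11; joint small-image axis O8 / N2 / N3; sequel of part 11c
# `IrreducibleModThreeCentralInvolution.lean`, which did `p = 3` by a central involution)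

HONEST FRAMING (cell `b2b-bsdres`, run/shared/lean/b2b/bsd-rank1-residual/, verbatim in every
file): the goal of the cell is to DELETE the COMBINATION-SHAPED residual classes of the
Birch–Swinnerton-Dyer formula for ALL analytic-rank `≤ 1` elliptic curves over `ℚ` — "full BSD
formula for every rank `≤ 1` curve in class `C`" assembled STRICTLY from published theorems — so
that the rank-`≤ 1` remainder becomes exactly the CONSTRUCTION-SHAPED classes, which are TYPED
(missing-input `Prop`s), NOT attempted. This is not "finishing BSD". THEOREMS ONLY: no definition,
no named fact, no conjecture node, nothing booked, no label of `RESIDUAL-MAP.md` moved; census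
counts are EVIDENCE, never a Literature fact.

## What this file does

Parts 11b/11c obtained Sakamoto's hypothesis (H.3) at level one (`T = T̄ = E[p]`:
`H¹(ℚ(E[p], μ_p)/ℚ, E[p]) = 0`, in the tree's inflation–restriction form) from a CENTRAL INVOLUTION
`−1` in the image — available on `(G) ∧ ss` rows at every odd `p` and on every irreducible row at
`p = 3`, but NOT in general on the `p ≥ 5` niveau-1 rows (part 11c, "NOT claimed"). The coprime-order
argument needs no involution:

* §1 (generic, Mathlib's `groupCohomology` of a finite group `H`)
  **`InflRes.cocycles₁_le_coboundaries₁_of_mul_card_smul`** — if `(u · #H) • x = x` on the module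
  (e.g. `#H` invertible on it), every `1`-cocycle `F` is a `1`-coboundary: with `v = Σ_h F(h)` one has
  `ρ(g) v = v − #H · F(g)`, so `F = ∂(−u v)` (the averaging argument, Serre *Local Fields* VIII §2
  Cor. 1: `#H` kills `Hⁿ(H, ·)`, `n ≥ 1`).
* §2 **`hH3_self_of_not_dvd_card_range`** — for `E/ℚ` and a prime `p` with
  `p ∤ #ρ̄_{E,p}(Γ_ℚ)`: (H.3) at level one. The finite quotient
  `Q = Γ_ℚ / (ker ρ̄_{E,p} ∩ Gal(ℚ̄/ℚ(μ_p))) = Gal(ℚ(E[p], μ_p)/ℚ)` has order dividing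
  `#ρ̄(Γ_ℚ) · [ℚ(μ_p) : ℚ]`, hence prime to `p` (`[ℚ(μ_p):ℚ] ∣ p − 1`), so `#Q` is invertible on the
  `p`-torsion group `E[p]` and §1 applies through n1011-p04's dictionary
  `InflRes.h3_of_isZero_H1_quotient` (first instantiation of the quotient form in the tree).
* §3 **`hH3_self_of_irr_of_not_surj`** — `E[p]` irreducible and `ρ̄_{E,p}` NOT onto ⟹ (H.3) at
  level one, at EVERY prime `p` (Serre 1972 Prop. 15: such an image has order prime to `p`; GEN 7
  `not_dvd_card_map_galoisRepTorsion_of_irr_of_not_surj`); with n1011-p04's surjective case: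
  **`hH3_self_of_irr`** — (H.3) at level one for EVERY `E/ℚ`, EVERY odd `p` with `E[p]` irreducible.
  Class forms **`O8.hH3_self`** (every O8 row, every `p`), **`ClassX9.hH3_self`** (N3 = X9 at
  `p ≥ 5`), **`ClassX10.hH3_self_three'`** (N2; part 11c's `ClassX10.hH3_self_three` re-derived).

E2 OBSTRUCTION ANATOMY of the Kolyvagin-system route on the small-image classes after parts 11–12
(THEOREM LEVEL): (H.2) ✗ on every O8 / N2 / N3 row, every level (part 11d); **(H.3) at level one ✓
on EVERY irreducible row at EVERY odd `p`** (here) and at every level `3^{k+1}` at `p = 3` (part 12a);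
(H.1) irreducibility ✓; Kato (12.5.2) ✗ (n1011-p04). NOT claimed: (H.3) at levels `p^{k+1}`,
`k ≥ 1`, `p ≥ 5` on small-image rows (`p ∣ #ρ̄_{E,p^{k+1}}(Γ_ℚ)` in general and `−1` need not be
in the image); `p = 2`; anything of BSD type; no label moves.

References: [Sakamoto2024] R. Sakamoto, JTNB 36 (2024) §2 (H.3); [MazurRubin2004] B. Mazur,
K. Rubin, Mem. AMS 799 (2004) §3.5, Lemma 3.5.2; J.-P. Serre, *Local Fields*, GTM 67, VIII §2
Cor. 1 (`#G · Hⁿ(G, A) = 0`); [Serre1972] J.-P. Serre, Invent. Math. 15 (1972) §2.4 Prop. 15;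
J.-P. Serre, *Galois Cohomology* (1997), I.§2.6(b).
-/

set_option autoImplicit false

noncomputable section

open scoped Classical NumberField Pointwise

open Field IsDedekindDomain NumberField WeierstrassCurve groupCohomology CategoryTheory.Limits
  Literature.NumberTheory.EllipticCurves Literature.NumberTheory.GaloisRepresentations
  Literature.NumberTheory.EllipticCurves.Rank1Residual
  Summit.BirchSwinnertonDyer.Rank1Residual.Additive

namespace Summit.BirchSwinnertonDyer.Rank1Residual.GaloisImage

/-! ## §1. A finite group of order invertible on the module has no `H¹` (averaging) -/

namespace InflRes

universe u

variable {k H : Type u} [CommRing k] [Group H]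

/-- **Averaging.** Let `H` be a finite group acting `k`-linearly on `A`, and suppose
`(u · #H) • x = x` for all `x ∈ A` (the order of `H` is invertible on `A`, with inverse `u`). Then
every `1`-cocycle `F : H → A` is a `1`-coboundary: for `v = Σ_h F h` the cocycle identity gives
`ρ(g) v = v − #H · F g`, so `F g = ρ(g)(−u v) − (−u v)`. Serre, *Local Fields* VIII §2 Cor. 1.
[folklore] -/
theorem cocycles₁_le_coboundaries₁_of_mul_card_smul [Finite H] (A : Rep k H) (u : ℕ)
    (hu : ∀ x : A, (u * Nat.card H) • x = x) :
    cocycles₁ A ≤ coboundaries₁ A := by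
  haveI := Fintype.ofFinite H
  intro F hF
  have hF' := (mem_cocycles₁_iff F).mp hF
  have key : ∀ g : H, A.ρ g (∑ h, F h) = (∑ h, F h) - Nat.card H • F g := by
    intro g
    rw [map_sum]
    have h1 : ∀ h, A.ρ g (F h) = F (g * h) - F g := fun h => by rw [hF' g h]; abel
    simp_rw [h1]
    rw [Finset.sum_sub_distrib, Finset.sum_const, Finset.card_univ, Nat.card_eq_fintype_card]
    congr 1
    exact Fintype.sum_equiv (Equiv.mulLeft g) _ _ fun h => rfl
  refine ⟨-(u • ∑ h, F h), funext fun g => ?_⟩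
  rw [d₀₁_hom_apply, map_neg, map_nsmul, key, smul_sub, ← mul_smul, hu (F g)]
  abel

/-- **Class form**: under the same hypothesis Mathlib's `H¹(H, A)` vanishes. [folklore] -/
theorem isZero_H1_of_mul_card_smul [Finite H] (A : Rep k H) (u : ℕ)
    (hu : ∀ x : A, (u * Nat.card H) • x = x) : IsZero (groupCohomology.H1 A) :=
  (cocycles₁_le_coboundaries₁_iff_isZero_H1 A).mp (cocycles₁_le_coboundaries₁_of_mul_card_smul A u hu)

end InflRes

/-! ## §2. (H.3) at level one from `p ∤ #ρ̄_{E,p}(Γ_ℚ)` -/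

section Rat

variable (W : WeierstrassCurve ℚ)

/-- The index of `Γ_{ℚ(E[p], μ_p)} = ker ρ̄_{E,p} ∩ Gal(ℚ̄/ℚ(μ_p))` in `Γ_ℚ` divides
`[ℚ(μ_p) : ℚ]`-index times `#ρ̄_{E,p}(Γ_ℚ)`; in particular it is prime to `p` when the image is.
[folklore] -/
theorem not_dvd_index_ker_inf_rootsOfUnityFixer (p : ℕ) [Fact p.Prime]
    (hG : ¬ p ∣ Nat.card (galoisRepTorsion W ((p : ℕ) : ℤ)).range) :
    ¬ p ∣ ((galoisRepTorsion W ((p : ℕ) : ℤ)).ker ⊓ rootsOfUnityFixer ℚ p).index := by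
  have hpP : p.Prime := Fact.out
  haveI : NeZero p := ⟨hpP.ne_zero⟩
  haveI : NeZero ((p : ℕ) : ℚ) := ⟨Nat.cast_ne_zero.mpr hpP.ne_zero⟩
  set A : Subgroup (absoluteGaloisGroup ℚ) := (galoisRepTorsion W ((p : ℕ) : ℤ)).ker with hA
  set B : Subgroup (absoluteGaloisGroup ℚ) := rootsOfUnityFixer ℚ p with hB
  haveI : B.Normal := InflRes.normal_rootsOfUnityFixer (K := ℚ) p
  have hAi : A.index = Nat.card (galoisRepTorsion W ((p : ℕ) : ℤ)).range := Subgroup.index_ker _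
  have hBi : B.index ∣ p - 1 := by
    rw [hB, rootsOfUnityFixer_eq_ker, Subgroup.index_ker, ← ZMod.card_units p,
      ← Nat.card_eq_fintype_card]
    exact Subgroup.card_subgroup_dvd_card _
  have hABi : (A ⊓ B).index ∣ B.index * A.index := by
    rw [← Subgroup.relIndex_mul_index (inf_le_left : A ⊓ B ≤ A), Subgroup.inf_relIndex_left A B]
    exact mul_dvd_mul (Subgroup.relIndex_dvd_index_of_normal B A) dvd_rfl
  intro h
  rcases (Nat.Prime.dvd_mul hpP).mp (h.trans hABi) with hBp | hAp
  · -- `p ∣ [ℚ(μ_p)-part] ∣ p − 1`: impossible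
    have hB0 : 0 < B.index := Nat.pos_of_dvd_of_pos hBi (Nat.sub_pos_of_lt hpP.one_lt)
    have h1 : p ≤ B.index := Nat.le_of_dvd hB0 hBp
    have h2 : B.index ≤ p - 1 := Nat.le_of_dvd (Nat.sub_pos_of_lt hpP.one_lt) hBi
    omega
  · exact hG (hAi ▸ hAp)

/-- **(H.3) of Sakamoto 2024 at LEVEL ONE from `p ∤ #ρ̄_{E,p}(Γ_ℚ)`** (`T = T̄ = E[p]`, any prime
`p`): every continuous crossed homomorphism `f : Γ_ℚ → E[p]` vanishing on
`ker ρ̄_{E,p} ∩ Gal(ℚ̄/ℚ(μ_p))` is principal. The quotient `Gal(ℚ(E[p], μ_p)/ℚ)` is a finite group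
of order prime to `p`, hence invertible on the `p`-torsion group `E[p]`; averaging (§1) kills its
`H¹`, and n1011-p04's dictionary `InflRes.h3_of_isZero_H1_quotient` translates.
[cite: Sakamoto2024, §2 (H.3)] [cite: MazurRubin2004, Lemma 3.5.2] -/
theorem hH3_self_of_not_dvd_card_range (p : ℕ) [Fact p.Prime]
    (hG : ¬ p ∣ Nat.card (galoisRepTorsion W ((p : ℕ) : ℤ)).range)
    (f : contOneCocycles (W.torsionGaloisModule ((p : ℕ) : ℤ)).toTopRep)
    (hf : ∀ u : absoluteGaloisGroup ℚ, (W.torsionGaloisModule ((p : ℕ) : ℤ)) u = 1 →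
        u ∈ rootsOfUnityFixer ℚ p → f.1 u = 0) :
    oneCocycleClass (W.torsionGaloisModule ((p : ℕ) : ℤ)).toTopRep f = 0 := by
  have hpP : p.Prime := Fact.out
  haveI : NeZero p := ⟨hpP.ne_zero⟩
  haveI : NeZero ((p : ℕ) : ℚ) := ⟨Nat.cast_ne_zero.mpr hpP.ne_zero⟩
  set N : Subgroup (absoluteGaloisGroup ℚ) :=
    (galoisRepTorsion W ((p : ℕ) : ℤ)).ker ⊓ rootsOfUnityFixer ℚ p with hNdef
  haveI hAn : (galoisRepTorsion W ((p : ℕ) : ℤ)).ker.Normal := MonoidHom.normal_ker _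
  haveI hBn : (rootsOfUnityFixer ℚ p).Normal := InflRes.normal_rootsOfUnityFixer (K := ℚ) p
  haveI : N.Normal := Subgroup.normal_inf_normal _ _
  -- every element of `N` acts trivially on `E[p]` and fixes `μ_p`
  have hNact : ∀ u ∈ N, ∀ x : geomTorsion W ((p : ℕ) : ℤ), u • x = x := fun u hu x =>
    (galoisRepTorsion_eq_one_iff' W ((p : ℕ) : ℤ) u).mp (MonoidHom.mem_ker.mp hu.1) x
  have hN : ∀ u ∈ N, (W.torsionGaloisModule ((p : ℕ) : ℤ)) u = 1 ∧ u ∈ rootsOfUnityFixer ℚ p :=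
    fun u hu =>
    ⟨LinearMap.ext fun x => by rw [torsionGaloisModule_apply_apply, hNact u hu x]; rfl, hu.2⟩
  haveI : Representation.IsTrivial
      ((W.torsionGaloisModule ((p : ℕ) : ℤ)).toTopRep.ρ.toRepresentation.comp N.subtype) :=
    ⟨fun n => LinearMap.ext fun x => by
      change (W.torsionGaloisModule ((p : ℕ) : ℤ)) (n : absoluteGaloisGroup ℚ) x = x
      rw [torsionGaloisModule_apply_apply, hNact _ n.2 x]⟩
  -- the finite quotient has order prime to `p`
  have hidx : ¬ p ∣ N.index := not_dvd_index_ker_inf_rootsOfUnityFixer W p hG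
  have hidx0 : N.index ≠ 0 := fun h0 => hidx (h0 ▸ dvd_zero p)
  haveI : Finite (absoluteGaloisGroup ℚ ⧸ N) := Nat.finite_of_card_ne_zero hidx0
  have hcard : Nat.card (absoluteGaloisGroup ℚ ⧸ N) = N.index := rfl
  obtain ⟨m, -, hm⟩ := Nat.exists_mul_mod_eq_one_of_coprime
    ((Nat.Prime.coprime_iff_not_dvd hpP).mpr hidx).symm hpP.one_lt
  -- `(m · #Q) • x = x` on `E[p]`
  have htors : ∀ x : geomTorsion W ((p : ℕ) : ℤ), p • x = 0 := fun x => by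
    have hx : ((p : ℕ) : ℤ) • (x : geomPoints W) = 0 := (Submodule.mem_torsionBy_iff _ _).mp x.2
    apply Subtype.ext
    rw [AddSubmonoidClass.coe_nsmul, ZeroMemClass.coe_zero, ← natCast_zsmul]
    exact hx
  have hu : ∀ x : geomTorsion W ((p : ℕ) : ℤ),
      (m * Nat.card (absoluteGaloisGroup ℚ ⧸ N)) • x = x := fun x => by
    rw [hcard, mul_comm, ← Nat.div_add_mod (N.index * m) p, hm, add_smul, one_smul, mul_smul,
      smul_comm, htors, smul_zero, zero_add]
  have hH : IsZero (groupCohomology.H1 (Rep.of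
      ((W.torsionGaloisModule ((p : ℕ) : ℤ)).toTopRep.ρ.toRepresentation.ofQuotient N))) :=
    InflRes.isZero_H1_of_mul_card_smul _ m hu
  exact InflRes.h3_of_isZero_H1_quotient (W.torsionGaloisModule ((p : ℕ) : ℤ))
    (W.torsionGaloisModule ((p : ℕ) : ℤ)) p N hN hH f hf

variable [W.IsElliptic]

/-- **(H.3) at level one on every small-image row, EVERY prime `p`**: `E[p]` irreducible and
`ρ̄_{E,p}` not onto ⟹ every continuous crossed homomorphism `Γ_ℚ → E[p]` vanishing on
`ker ρ̄_{E,p} ∩ Gal(ℚ̄/ℚ(μ_p))` is principal (the image has order prime to `p`: Serre Prop. 15).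
[cite: Sakamoto2024, §2 (H.3)] [cite: Serre1972, §2.4 Prop. 15] -/
theorem hH3_self_of_irr_of_not_surj (p : ℕ) [Fact p.Prime] (hirr : Irr W p) (hns : ¬ Surj W p)
    (f : contOneCocycles (W.torsionGaloisModule ((p : ℕ) : ℤ)).toTopRep)
    (hf : ∀ u : absoluteGaloisGroup ℚ, (W.torsionGaloisModule ((p : ℕ) : ℤ)) u = 1 →
        u ∈ rootsOfUnityFixer ℚ p → f.1 u = 0) :
    oneCocycleClass (W.torsionGaloisModule ((p : ℕ) : ℤ)).toTopRep f = 0 := by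
  refine hH3_self_of_not_dvd_card_range W p ?_ f hf
  rw [MonoidHom.range_eq_map]
  exact not_dvd_card_map_galoisRepTorsion_of_irr_of_not_surj W p hirr hns ⊤

/-- **(H.3) at level one for EVERY `E/ℚ` and EVERY odd prime `p` with `E[p]` irreducible**
(onto: n1011-p04's `hH3_self_of_hasSurjectiveModNGaloisRep`; not onto: the coprime order).
[cite: Sakamoto2024, §2 (H.3)] [cite: Serre1972, §2.4 Prop. 15] -/
theorem hH3_self_of_irr (p : ℕ) [Fact p.Prime] (hp : p ≠ 2) (hirr : Irr W p)
    (f : contOneCocycles (W.torsionGaloisModule ((p : ℕ) : ℤ)).toTopRep)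
    (hf : ∀ u : absoluteGaloisGroup ℚ, (W.torsionGaloisModule ((p : ℕ) : ℤ)) u = 1 →
        u ∈ rootsOfUnityFixer ℚ p → f.1 u = 0) :
    oneCocycleClass (W.torsionGaloisModule ((p : ℕ) : ℤ)).toTopRep f = 0 := by
  by_cases hs : Surj W p
  · exact hH3_self_of_hasSurjectiveModNGaloisRep W p hp hs f hf
  · exact hH3_self_of_irr_of_not_surj W p hirr hs f hf

/-! ## §3. Class forms: O8 (every `p`), N3 = X9, N2 = X10b -/

/-- **O8 (`ClassX4 W p ∧ ¬ Surj W p`, EVERY prime `p`, all reduction types): (H.3) at level one.**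
[cite: Sakamoto2024, §2 (H.3)] [cite: Serre1972, §2.4 Prop. 15] -/
theorem O8.hH3_self {p : ℕ} [Fact p.Prime] (hX : ClassX4 W p) (hns : ¬ Surj W p)
    (f : contOneCocycles (W.torsionGaloisModule ((p : ℕ) : ℤ)).toTopRep)
    (hf : ∀ u : absoluteGaloisGroup ℚ, (W.torsionGaloisModule ((p : ℕ) : ℤ)) u = 1 →
        u ∈ rootsOfUnityFixer ℚ p → f.1 u = 0) :
    oneCocycleClass (W.torsionGaloisModule ((p : ℕ) : ℤ)).toTopRep f = 0 :=
  hH3_self_of_irr_of_not_surj W p hX.2.2 hns f hf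

/-- **O8, surjective or not (`ClassX4 W p`, `p` odd by the class definition): (H.3) at level one.**
[cite: Sakamoto2024, §2 (H.3)] -/
theorem O8.hH3_self_of_classX4 {p : ℕ} [Fact p.Prime] (hX : ClassX4 W p)
    (f : contOneCocycles (W.torsionGaloisModule ((p : ℕ) : ℤ)).toTopRep)
    (hf : ∀ u : absoluteGaloisGroup ℚ, (W.torsionGaloisModule ((p : ℕ) : ℤ)) u = 1 →
        u ∈ rootsOfUnityFixer ℚ p → f.1 u = 0) :
    oneCocycleClass (W.torsionGaloisModule ((p : ℕ) : ℤ)).toTopRep f = 0 :=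
  hH3_self_of_irr W p hX.1 hX.2.2 f hf

/-- **N3 = X9 (`p ≥ 5`, good ordinary, `Irr ∧ ¬ Surj`): (H.3) at level one.**
[cite: Sakamoto2024, §2 (H.3)] [cite: Serre1972, §2.4 Prop. 15] -/
theorem ClassX9.hH3_self {p : ℕ} [Fact p.Prime] [W.IsGloballyMinimal] (h : ClassX9 W p)
    (f : contOneCocycles (W.torsionGaloisModule ((p : ℕ) : ℤ)).toTopRep)
    (hf : ∀ u : absoluteGaloisGroup ℚ, (W.torsionGaloisModule ((p : ℕ) : ℤ)) u = 1 →
        u ∈ rootsOfUnityFixer ℚ p → f.1 u = 0) :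
    oneCocycleClass (W.torsionGaloisModule ((p : ℕ) : ℤ)).toTopRep f = 0 :=
  hH3_self_of_irr_of_not_surj W p h.2.2.2.1 h.2.2.2.2.1 f hf

/-- **N2 = X10b (class X10: good ordinary at `3`, `Irr W 3`, any image): (H.3) at level one at
`3`** — part 11c's `ClassX10.hH3_self_three` by the coprime route when the image is small.
[cite: Sakamoto2024, §2 (H.3)] -/
theorem ClassX10.hH3_self_three' {p : ℕ} [Fact p.Prime] [W.IsGloballyMinimal] (h : ClassX10 W p)
    (f : contOneCocycles (W.torsionGaloisModule ((3 : ℕ) : ℤ)).toTopRep)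
    (hf : ∀ u : absoluteGaloisGroup ℚ, (W.torsionGaloisModule ((3 : ℕ) : ℤ)) u = 1 →
        u ∈ rootsOfUnityFixer ℚ 3 → f.1 u = 0) :
    oneCocycleClass (W.torsionGaloisModule ((3 : ℕ) : ℤ)).toTopRep f = 0 :=
  haveI : Fact (Nat.Prime 3) := ⟨Nat.prime_three⟩
  hH3_self_of_irr W 3 (by decide) h.2.2.1 f hf

end Rat

end Summit.BirchSwinnertonDyer.Rank1Residual.GaloisImage

end
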